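import Summits.CriticalPhenomena.PercolationContinuityZ3.Theorems.Transplant.FKDoubleFanNegCorrAdjacent
import HarnessLib

/-!
# Double fans `K₂ ∨ P_{m+1}`: the axis is negatively correlated with EVERY spoke

Support file (`--supports stmt-CriticalPhenomena-4575`), FK sub-lane `prim-bschramm-fk-3` (gen 21); builds on p205010 (kernel theorem, internal
audit signed; external expert review pending).  No named facts, no sorries; standard axioms.  Memo `bschramm/prim-bschramm-fk-3/DOUBLE-FAN.md` §3, §8.
Layer 5 of the double-fan bridge.  The axis letter `edgeAB` commutes with every letter (the fibre-mass monoid is commutative) and with the rim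
step (`rimStep_conv_edgeAB`), so pinning the axis FACTORS OUT of the transfer word at every block (**`zDF_axis_factor`**:
`Z_j(w[ab ↦ τ]) = edgeAB(τ) ∗ Z_j(w[ab ↦ 0])`).  Hence the axis and the spoke `a c_j` of ANY rim vertex are a same-block pair of the three-apex
calculus with rest `restVec_j ∗ edgeBC(w_{b c_j}) ∗ blockIn_j(w[ab ↦ 0]) ∈ InKE q` (**`cut_pin_axis_spokeA_at`**), and the master inequality
`N^{(bc)} ≥ 0` on `InKE` (`…ThreeApexRimStep`) with `rayleigh_AC_AB_eq` (`…DoubleFanNegCorrAdjacent`) gives **`negCorr_axis_spokeA`** /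
**`negCorr_axis_spokeB`**: for `0 < q ≤ 1`, every weight vector on the double fan and every `j ≤ m`,
`φ(J_{a c_j} ∩ J_{ab}) ≤ φ(J_{a c_j}) φ(J_{ab})` (and the same for `b c_j`) — superseding the `j = 0` case of layer 4.
NOT here: the axis against a RIM edge, which is a cross-`c` pair of generalized-T5 type (memo §5; it needs the `U`-forms, gen 21 notes).
[cite: Grimmett2006, §3.9 eq. (3.94) (pp. 63–64); §1.4 eq. (1.20) (p. 15)] [folklore]
-/

noncomputable section

namespace Summit.CriticalPhenomena.PercolationContinuityZ3.Theorems

namespace FK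

namespace ThreeApex

open MeasureTheory Literature.Probability.LatticeModels Literature.Probability.Percolation
open scoped Classical

variable {V : Type*} [Fintype V]

section Setting

variable {a b : V} {c : ℕ → V} {m : ℕ}
variable (hab : a ≠ b) (hinj : ∀ j k, j ≤ m → k ≤ m → c j = c k → j = k) (hca : ∀ j, j ≤ m → c j ≠ a) (hcb : ∀ j, j ≤ m → c j ≠ b)
include hab hinj hca hcb

/-! ### The axis factors out of the word -/

omit [Fintype V] hinj in
/-- **Axis factorization.**  Pinning the axis to `τ` multiplies the axis-deleted word by the letter `edgeAB(τ)` at every block `j ≤ m`: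
`Z_j(w[ab ↦ τ]) = edgeAB(τ) ∗ Z_j(w[ab ↦ 0])` (the axis letter commutes with all letters and with the rim step). [folklore] -/
theorem zDF_axis_factor (q : ℝ) (w : Sym2 V → unitInterval) (τ : unitInterval) :
    ∀ j, j ≤ m → zDF q (Function.update w s(a, b) τ) a b c j = conv (edgeAB (τ : ℝ)) (zDF q (Function.update w s(a, b) 0) a b c j) := by
  intro j
  induction j with
  | zero =>
    intro _
    have h0 : 0 ≤ m := Nat.zero_le _
    simp only [zDF, wR_update_self, Set.Icc.coe_zero, wR_update_of_ne w (spokeA_ne_axis hab hcb h0),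
      wR_update_of_ne w (spokeB_ne_axis hab hca h0)]
    simp only [← mul_def, ← one_def, mul_one]
    have e0 : edgeAB (0 : ℝ) = 1 := by rw [one_def]; ext <;> simp [edgeAB, delta0]
    rw [e0, mul_one, mul_comm (edgeBC _) (edgeAB _), mul_left_comm (edgeAC _) (edgeAB _)]
  | succ j ih =>
    intro hj
    have hj' : j + 1 ≤ m := hj
    simp only [zDF, wR_update_of_ne w (spokeA_ne_axis hab hcb hj'), wR_update_of_ne w (spokeB_ne_axis hab hca hj'),
      wR_update_of_ne w (rim_ne_axis hca hj'), ih (by omega), rimStep_conv_edgeAB]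
    simp only [← mul_def]
    rw [mul_left_comm (edgeBC _) (edgeAB _), mul_left_comm (edgeAC _) (edgeAB _)]

/-! ### The axis and the `a`-spoke of any rim vertex -/

omit [Fintype V] in
/-- **The word with the axis and the spoke `a c_j` pinned** (`j ≤ m`), through the cut at block `j`: the four partition functions are
`val(edgeAC(σ) ∗ edgeAB(τ) ∗ R)` with the rest `R = restVec_j ∗ edgeBC(w_{b c_j}) ∗ blockIn_j(w[ab ↦ 0])`. [folklore] -/
theorem cut_pin_axis_spokeA_at (q : ℝ) (w : Sym2 V → unitInterval) {j : ℕ} (hj : j ≤ m) (σ τ : unitInterval) :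
    transferDF q (Function.update (Function.update w s(a, c j) σ) s(a, b) τ) a b c m =
      val q (conv (edgeAC (σ : ℝ)) (conv (edgeAB (τ : ℝ))
        (conv (restVec q w a b c j (m - j)) (conv (edgeBC (wR w s(b, c j))) (blockIn q (Function.update w s(a, b) 0) a b c j))))) := by
  set w₁ := Function.update w s(a, c j) σ with hw₁
  set w₂ := Function.update w₁ s(a, b) τ with hw₂
  have hlater1 : ∀ k, j < k → k ≤ m → ¬ ReadsAt a b c k s(a, c j) := fun k hk hkm hr =>
    absurd ((readsAt_spokeA_iff hab hinj hca hcb hj hkm).1 hr) (by omega)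
  have hlater2 : ∀ k, j < k → k ≤ m → ¬ ReadsAt a b c k s(a, b) := fun k hk hkm hr =>
    absurd ((readsAt_axis_iff hab hca hcb hkm).1 hr) (by omega)
  have hrest : restVec q w₂ a b c j (m - j) = restVec q w a b c j (m - j) := by
    rw [hw₂, restVec_update_eq q w₁ τ (m - j) j (by omega) hlater2, hw₁, restVec_update_eq q w σ (m - j) j (by omega) hlater1]
  -- the word of `w₂` at block `j`, with the axis factored out
  have hfac := zDF_axis_factor hab hca hcb q w₁ τ j hj
  set w₃ := Function.update w₁ s(a, b) 0 with hw₃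
  have hσ : wR w₃ s(a, c j) = (σ : ℝ) := by
    rw [hw₃, wR_update_of_ne w₁ (spokeA_ne_axis hab hcb hj), hw₁, wR_update_self]
  have hy : wR w₃ s(b, c j) = wR w s(b, c j) := by
    rw [hw₃, wR_update_of_ne w₁ (spokeB_ne_axis hab hca hj), hw₁, wR_update_of_ne w (spokeA_ne_spokeB hab hca hj).symm]
  have hin : blockIn q w₃ a b c j = blockIn q (Function.update w s(a, b) 0) a b c j := by
    rw [hw₃, hw₁, Function.update_comm (spokeA_ne_axis hab hcb hj)]
    exact blockIn_update_eq q (Function.update w s(a, b) 0) σ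
      (fun k hk hr => absurd ((readsAt_spokeA_iff hab hinj hca hcb hj (by omega)).1 hr) (by omega))
      (spokeA_ne_axis hab hcb hj) (fun i hi => hi ▸ spokeA_ne_rim hca (j := i + 1) (hi ▸ hj))
  rw [transferDF_eq_cut q w₂ a b c hj, hrest, hw₂, hfac, zDF_eq_block q w₃ a b c j, hσ, hy, hin]
  -- reassociate: s ∗ (AB τ ∗ (AC σ ∗ (BC y ∗ W))) = AC σ ∗ (AB τ ∗ (s ∗ (BC y ∗ W)))
  simp only [← mul_def]
  rw [mul_left_comm (restVec q w a b c j (m - j)) (edgeAB _), mul_left_comm (restVec q w a b c j (m - j)) (edgeAC _),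
    mul_left_comm (edgeAB _) (edgeAC _)]

/-- **THE AXIS AND THE SPOKE `a c_j` ARE NEGATIVELY CORRELATED** in every weighted double fan `K₂ ∨ P_{m+1}` (`0 < q ≤ 1`, `card V = m + 3`,
`w` supported on the double fan), for EVERY `j ≤ m`: `φ(J_{a c_j} ∩ J_{ab}) ≤ φ(J_{a c_j}) φ(J_{ab})`. [cite: Grimmett2006, §3.9 eq. (3.94) (pp. 63–64)] -/
theorem negCorr_axis_spokeA (hcard : Fintype.card V = m + 3) {q : ℝ} (hq0 : 0 < q) (hq1 : q ≤ 1) (w : Sym2 V → unitInterval)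
    (hsupp : ∀ e, e ∉ dfPairs a b c m → w e = 0) {j : ℕ} (hj : j ≤ m) :
    (rcMeasureW w q ∅).real ({ω : BondConfig V | s(a, c j) ∈ ω} ∩ {ω | s(a, b) ∈ ω}) ≤
      (rcMeasureW w q ∅).real {ω : BondConfig V | s(a, c j) ∈ ω} * (rcMeasureW w q ∅).real {ω : BondConfig V | s(a, b) ∈ ω} := by
  have he : s(a, c j) ∈ dfPairs a b c m := (mem_dfPairs_iff a b c m _).2 (Or.inr (Or.inl ⟨j, hj, Or.inl rfl⟩))
  have hf : s(a, b) ∈ dfPairs a b c m := (mem_dfPairs_iff a b c m _).2 (Or.inl rfl)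
  have hne : s(a, b) ≠ s(a, c j) := (spokeA_ne_axis hab hcb hj).symm
  set R := conv (restVec q w a b c j (m - j)) (conv (edgeBC (wR w s(b, c j))) (blockIn q (Function.update w s(a, b) 0) a b c j))
    with hR
  have hZ : ∀ σ τ : unitInterval, rcPartitionFunctionW (Function.update (Function.update w s(a, c j) σ) s(a, b) τ) q ∅ =
      val q (conv (edgeAC (σ : ℝ)) (conv (edgeAB (τ : ℝ)) R)) := by
    intro σ τ
    rw [rcPartitionFunctionW_eq_transferDF hab hinj hca hcb hcard q _
      (supp_update_dfPair _ (supp_update_dfPair w hsupp he σ) hf τ),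
      cut_pin_axis_spokeA_at hab hinj hca hcb q w hj σ τ]
  have hRK : InKE q R := InKE.mul (inKE_restVec q w a b c (m - j) j)
    (InKE.step (IsLetter.bc (w _).2.1 (w _).2.2) (inKE_blockIn q (Function.update w s(a, b) 0) a b c j))
  have hN : 0 ≤ masterN q (swapAB R) := (hRK.valid hq0.le hq1).nBC
  refine negCorr_of_pinned_rayleigh w hq0 hne ?_
  rw [hZ 1 1, hZ 0 0, hZ 1 0, hZ 0 1]
  simp only [Set.Icc.coe_one, Set.Icc.coe_zero]
  have hid := rayleigh_AC_AB_eq q R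
  have hq' : 0 ≤ 1 - q := sub_nonneg.2 hq1
  nlinarith [hid, hN, mul_nonneg (mul_nonneg (pow_nonneg hq0.le 2) hq') hN]

/-- **THE AXIS AND THE SPOKE `b c_j` ARE NEGATIVELY CORRELATED** (`a ↔ b` relabelling of `negCorr_axis_spokeA`), every `j ≤ m`. [cite: Grimmett2006, §3.9 eq. (3.94) (pp. 63–64)] -/
theorem negCorr_axis_spokeB (hcard : Fintype.card V = m + 3) {q : ℝ} (hq0 : 0 < q) (hq1 : q ≤ 1) (w : Sym2 V → unitInterval)
    (hsupp : ∀ e, e ∉ dfPairs a b c m → w e = 0) {j : ℕ} (hj : j ≤ m) :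
    (rcMeasureW w q ∅).real ({ω : BondConfig V | s(b, c j) ∈ ω} ∩ {ω | s(a, b) ∈ ω}) ≤
      (rcMeasureW w q ∅).real {ω : BondConfig V | s(b, c j) ∈ ω} * (rcMeasureW w q ∅).real {ω : BondConfig V | s(a, b) ∈ ω} := by
  have h := negCorr_axis_spokeA hab.symm hinj hcb hca hcard hq0 hq1 w (fun e he => hsupp e (by rwa [dfPairs_swap] at he)) hj
  rwa [Sym2.eq_swap (a := b) (b := a)] at h

end Setting

end ThreeApex

end FK

end Summit.CriticalPhenomena.PercolationContinuityZ3.Theorems
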